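/-
Origin: expansion seat `planner-pub-hodgecm-prl2-0`, handover addendum 3 2026-08-18T03:42:38Z (`HOME/pub-hodgecm-prl2/lean/Prl2/RealisationReduction.lean`, md5 ff67b580, 358 lines);
landed by the gen-5 packager in gate run 19 REPLACES the run-18 copy of `HodgeCM/StubTree/RealisationReduction.lean` (verbatim).
-/
/-
Copyright: pub-hodgecm formalisation cell (harness21, 2026). New file (not vendored).
-/
import Summits.HodgeConjecture.HodgeCM.Assembly.CorCM

/-!
# The realisation inputs REDUCED to printed non-vanishing theorems (strategy 2: reduce, don't construct)

The two open inputs `Universe.RealisationExistsPerL/Face` (`HodgeCM.StubTree.Inputs`) are consumed by exactly one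
theorem, `StubTree.thm44_of_realisation : ThetaRealisation → PeriodNV`; everything downstream (`PerL44`, `PeriodThmF`,
`W_RK4`, `PerL`, `COR_CM`) needs only `PeriodNV`.  This file gives `PeriodNV` from THREE statements over the `Universe`
primitives alone — no posited analytic data (`L²` spaces, isolation setting, `Λ`, Petersson identity) — and re-derives the
headline theorems from them:

```
 (V)  VirtualCup11         two nonzero classes in H¹(P_Γ, ℂ) have Hecke translates at a deeper level whose cup product is
                           nonzero.  IN PRINT: Venkataramana, Compositio Math. 125 (2001) 221–253, THEOREM 8 (p. 229):
                           "Let G(ℝ) = SU(n,1) up to compact factors. Let a, a′ be non-zero cohomology classes of degrees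
                           k, k′ in H(Sh⁰G) with k + k′ ≤ n. Then there exists a g ∈ Ḡ_f such that g(a) ∧ a′ ≠ 0"
                           (n = 2, k = k′ = 1; G = Res SU(V₃,h) anisotropic, p. 223); = Bergeron, C. R. Math. Acad. Sci.
                           Paris 339 (2004) 751–756, Thm 1.1 (p. 753) for (p,q) = (1,2), k + l = 2 ≤ p + q − 1; holomorphic
                           case: Clozel, J. reine angew. Math. 444 (1993) 1–15 ([C2] loc. cit.).  A MODEL-FACT candidate
                           `Fact_virtualCup11` (FACTS.md row to be numbered by the writer): it replaces the field `ThetaRealisation.lineField` (PerL v5 Prop 4.3,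
                           the v1→v2 repair point) by a published theorem.
 (S)  TypeSupplyAt         at some level all four isotypic spaces `U_{Ψ_i}(Γ)` are nonzero ("`B_{Ψ_i}` is an isogeny factor
                           of Alb(P_Γ)", [Y1neg] v2 Thm 8.1(a) ⊇ for the four types + non-vanishing of the theta supply).
                           Print part: Kazhdan 1977 / Borel–Wallach VIII / Li, J. reine angew. Math. 428 (1992) Thm 1.1
                           (non-vanishing of theta lifts from U(1) on cocompact quotients of U(2,1)) = Bergeron, arXiv:math/0612447
                           eq. (BW) p. 3.  NOT in print for `L₀ ≠ ℚ`: the CM-TYPING DICTIONARY "theta one-forms lifted from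
                           U(W), W a line of sign pattern s, lie in U_{Ψ(s)}" = [Y1neg] v2 Thm 8.1(a)/Prop 5.2/Lemma 4.2
                           (internal; `L₀ = ℚ`: Murty–Ramakrishnan, in *The zeta functions of Picard modular surfaces*, CRM
                           1992, 445–464).  ← THE OBSTRUCTION.
 (P)  PairingAt            a nonzero wedge `ω₀ ∪ ω₁` of one-forms of types (Ψ₀,Ψ₁) pairs non-trivially, after raising the
                           level, with SOME wedge of one-forms of types (Ψ₂,Ψ₃):  `∫ h^*(ω₀∧ω₁) ∧ \overline{ω₂∧ω₃} ≠ 0`;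
 (P♯) FreePairingAt        the same with the two given forms translated separately (implied by (V) ∧ (P)).
                           NEITHER IS VERBATIM IN PRINT.  In the intended model both come down to ONE statement about the
                           unitary group `U(W)` of the plane `W = W₀′ ⊕ W₁′` (definite at the place of `ι₁`) carrying the
                           constituent `Π = θ_W(σ)` met by the given wedge: `σ` has a non-zero toric period for a torus
                           `U(W₂′) × U(W₃′) ⊂ U(W)` of the complementary sign types and a character of the infinity type
                           prescribed by `(Ψ₂,Ψ₃)`.  PRINT INGREDIENTS: Kudla's seesaw identity (Progr. Math. 46, 1984); Howe
                           duality and the theta correspondence for (U(2),U(3)) (Gelbart–Rogawski–Soudry, Ann. of Math. 145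
                           (1997); Rogawski, Ann. of Math. Stud. 123 (1990) §13); EXISTENCE of a toric character with
                           prescribed local components and non-zero period: D. Prasad, Duke Math. J. 138 (2007) =
                           arXiv:math/0512151, Lemma 1 (p. 5: globalisation by weak approximation; stated for finite places —
                           we use its archimedean variant, the tori being compact at the real places); CHARACTERISATION
                           (optional): Waldspurger, Compositio Math. 54 (1985) Prop. 7 (toric period ≠ 0 ⟺
                           `L(1/2, BC(σ) ⊗ Ω⁻¹) ≠ 0` and local conditions) with Tunnell, Amer. J. Math. 105 (1983) / Saito,
                           Compositio Math. 85 (1993), verbatim as Yuan–Zhang–Zhang, Ann. of Math. Stud. 184 (2013) Thms 1.3,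
                           1.4 and as Prasad, loc. cit. Thms 3, 4 (p. 6); Landherr 1936 for `W₂′ ⊕ W₃′ ≅ W`
                           (= `HodgeCM.Lemma33bLandherr` + `StubTree.pairSum_of_isPerLTypes`).  ASSEMBLY (archimedean
                           branching/compatibility of the prescribed infinity types with `σ_∞`, central characters,
                           Hecke-projector unfolding `∫ T_g a ∧ b = ∫ π₂^*a ∧ π₁^*b`, archimedean variant of Prasad's
                           lemma): internal — PerL v5 §3 (Thm 3.7 `S₁₂ = S₃₄`, L3.5,
                           L4.2(b)) proves a stronger Hilbert-space statement by isolation; Bergeron, arXiv:math/0612447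
                           (2006, unpublished) Thm 1.2 (p. 4) gives verbatim only the case of his Remark (Hecke translates
                           of ONE Borel–Wallach class and its conjugate, `η₁∧η₂∧η̄₃∧η̄₄ ≠ 0`, r = s = 2 ≤ p), i.e. four
                           EQUAL types, not four prescribed distinct ones.
```
`periodNV_of_pieces : Fact_pull_comp → (S) → (V) → (P) → PeriodNV` is PROVED (pullbacks preserve `U_Ψ`: `pullC_mem_Uiso`;
multilinear expansion: `periodNV_of_period_ne_zero`), hence `perL44_of_pieces`, `periodThmF_of_pieces`, `perL_of_pieces`,
`COR_CM_of_pieces`.  HONESTY: (S) is implied by `PeriodNV` (`typeSupplyAt_of_periodNV`); (V) and (P) are not (they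
quantify over all classes) and neither implies `PeriodNV` alone ((P) is vacuous when all cup products vanish, which (V)+(S)
exclude; (V) says nothing about periods).  None of the three is `False` in the intended model (sources above).

Reduction dossier (statement-by-statement source map with page references, THE OBSTRUCTION, reconciliation with the
construction route `HodgeCM.Automorphic.*` / `HodgeCM.Proofs.RealisationConstruction`): `HOME/pub-hodgecm-prl2/REDUCTION.md`.
-/

noncomputable section

namespace HodgeCM

namespace Universe

variable (U : Universe)

open Literature.AlgebraicGeometry.Motives (CMType)

/-! ### (V) Virtual non-vanishing of cup products of degree-one classes (Venkataramana 2001, Thm 8) -/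

/-- **Virtual non-vanishing of `H¹ ∪ H¹` on the tower of `(V₃,h)`**: for nonzero `ω, η ∈ H¹(P_Γ, ℂ)` there are a level
`Γ′` and two morphisms `f, g : P_{Γ′} → P_Γ` of the tower (a Hecke translate composed with the covering, and the covering)
with `f^*ω ∪ g^*η ≠ 0` in `H²(P_{Γ′}, ℂ)`.  SOURCE (verbatim): Venkataramana, *Cohomology of compact locally symmetric
spaces*, Compositio Math. 125 (2001), THEOREM 8, p. 229 — "Let G(ℝ) = SU(n,1) up to compact factors. Let a, a′ be non-zero
cohomology classes of degrees k, k′ in H(Sh⁰G) with k + k′ ≤ n. Then there exists a g ∈ Ḡ_f such that g(a) ∧ a′ ≠ 0";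
here `G = Res_{L₀/ℚ} SU(V₃,h)`, anisotropic when `[L:ℚ] ≥ 4` (signature `(3,0)` at some place), so `S_Γ` is compact
(loc. cit. p. 223), `n = 2`, `k = k′ = 1`; `H(Sh⁰G) = lim_Γ H^*(Γ\𝔹², ℂ)` over congruence `Γ`, and `g(a) ∧ a′ ≠ 0` in the
limit is realised on a principal congruence level `Γ(N) ⊂ U(V₃,h)`, `N ≥ 3` (then `det Γ(N) = 1`: norm-one units `≡ 1 (N)`
are trivial), by pullback along morphisms of varieties.  Also Bergeron, C. R. Math. Acad. Sci. Paris 339 (2004) Thm 1.1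
(p. 753; `(p,q) = (1,2)`, `k + l ≤ p + q − 1 = 2`); holomorphic classes: Clozel, J. reine angew. Math. 444 (1993) 1–15.
WHY IT MIGHT FAIL: only as typed — if `U.Mor` between two levels of the intended model omitted the Hecke-translated
coverings (it does not: `Mor` is all morphisms of varieties). -/
def VirtualCup11 {L : CMField} {ι₁ : L →+* ℂ} (V : HermSpace3 L ι₁) : Prop :=
  ∀ (Γ : Level V) (ω η : U.CohC (U.pms L ι₁ V Γ) 1), ω ≠ 0 → η ≠ 0 →
    ∃ (Γ' : Level V) (f g : U.Mor (U.pms L ι₁ V Γ') (U.pms L ι₁ V Γ)),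
      U.cup2C (U.pms L ι₁ V Γ') 1 (U.pullC f 1 ω) (U.pullC g 1 η) ≠ 0

/-- **Model-fact candidate** (FACTS.md §1 row to be numbered by the writer): Venkataramana's Theorem 8 for every compact Picard modular tower of the universe
(`[L:ℚ] ≥ 4`, i.e. `g ≥ 2`, so that `(V₃,h)` is anisotropic and `P_Γ = Γ\𝔹²` is compact).  A standard published theorem
about the intended model, stated over the primitives `pms, Mor, pull, cup`, not mentioning algebraicity (FACTS.md,
AMENDMENT 2).  Consumed below as an explicit hypothesis `(hV : U.Fact_virtualCup11)`. -/
def Fact_virtualCup11 : Prop :=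
  ∀ (L : CMField) (ι₁ : L →+* ℂ), 4 ≤ Module.finrank ℚ L → ∀ V : HermSpace3 L ι₁, U.VirtualCup11 V

/-! ### (S) Supply of the four types and (P) the pairing step -/

/-- **(S) Type supply**: at some level `Γ` every isotypic space `U_{Ψ_i}(Γ) ⊂ H¹(P_Γ, ℂ)` (`Universe.Uiso`) is nonzero,
i.e. `B_{Ψ_i}` is an isogeny factor of `Alb(P_Γ)` with a `σ`-eigen one-form pulling back non-trivially, for all four `i`
at once.  SOURCES: existence of nonzero theta one-forms for every line `W` — Kazhdan, J. Analyse Math. 32 (1977);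
Borel–Wallach (Ann. of Math. Stud. 94) Ch. VIII; Li, J. reine angew. Math. 428 (1992) Thm 1.1; Bergeron
arXiv:math/0612447 eq. (BW) p. 3 — IN PRINT; that these forms lie in `U_{Ψ(s(W))}` (the CM-typing dictionary) — [Y1neg] v2
Thm 8.1(a), Prop 5.2, Lemma 4.2 (internal, refereed in the 2001 programme, unpublished); `L₀ = ℚ`: Murty–Ramakrishnan 1992.
THIS PIECE CARRIES THE OBSTRUCTION (the dictionary for `L₀ ≠ ℚ`).  WHY IT MIGHT FAIL: a sign-convention slip in the
dictionary would permute the four types (harmless for supply, all `2^{g-1}` types through `ι₁` occur); congruence is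
load-bearing (Schoen 2014: non-congruence ball quotients with non-CM Albanese).  Implied by `PeriodNV`
(`typeSupplyAt_of_periodNV`); the assembly uses `i = 0, 1`. -/
def TypeSupplyAt {L : CMField} {ι₁ : L →+* ℂ} (V : HermSpace3 L ι₁) (K : CMField) (Ψ : Fin 4 → CMType K)
    (σ : K →+* ℂ) : Prop :=
  ∃ Γ : Level V, ∀ i : Fin 4, U.Uiso Γ K (Ψ i) σ ≠ ⊥

/-- **(P) Pairing step**: a nonzero cup product `ω₀ ∪ ω₁` of one-forms of types `(Ψ₀, Ψ₁)` at level `Γ` pairs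
non-trivially — after pulling back along some morphism `h : P_{Γ′} → P_Γ` of the tower — with some pair of one-forms of
types `(Ψ₂, Ψ₃)` at level `Γ′`: `∫_{P_{Γ′}} h^*ω₀ ∧ h^*ω₁ ∧ \overline{ω₂ ∧ ω₃} ≠ 0`.  NOT VERBATIM IN PRINT (file header, entry
(P)): print ingredients = seesaw (Kudla 1984) + Howe duality for (U(2),U(3)) + toric periods on `U(W)`, `W = W₀′ ⊕ W₁′`
(existence of a good toric character: Prasad, Duke Math. J. 138 (2007) Lemma 1, archimedean variant; characterisation:
Waldspurger 1985 Prop. 7 with Tunnell 1983 / Saito 1993 = Yuan–Zhang–Zhang 2013 Thms 1.3–1.4) + Landherr; assembly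
(archimedean branching, central characters, projector unfolding, archimedean globalisation) internal — PerL v5 §3 isolation (Thm 3.7,
L3.5, L4.2(b), Petersson = period) is the programme's own stronger form (= the fields `gen12/real34/inner_Λ/Λ_cover` of
`ThetaRealisation`).  WHY IT MIGHT FAIL: as typed it asks the pairing for EVERY nonzero wedge of isotypic forms at every
level; a constituent `Π = θ_W(σ)` met by such a wedge must then be met by a `(Ψ₂,Ψ₃)`-wedge, which fails if the infinity
types prescribed by `(Ψ₂,Ψ₃)` were incompatible with `σ_∞` — excluded exactly by the pair-sum / sign bookkeeping of PerL
L3.3 (internal); a universe with an exotic morphism `h` is harmless (`∃ h`). -/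
def PairingAt {L : CMField} {ι₁ : L →+* ℂ} (V : HermSpace3 L ι₁) (K : CMField) (Ψ : Fin 4 → CMType K)
    (σ : K →+* ℂ) : Prop :=
  ∀ (Γ : Level V) (ω₀ ω₁ : U.CohC (U.pms L ι₁ V Γ) 1),
    ω₀ ∈ U.Uiso Γ K (Ψ 0) σ → ω₁ ∈ U.Uiso Γ K (Ψ 1) σ →
    U.cup2C (U.pms L ι₁ V Γ) 1 ω₀ ω₁ ≠ 0 →
    ∃ (Γ' : Level V) (h : U.Mor (U.pms L ι₁ V Γ') (U.pms L ι₁ V Γ))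
      (ω : Fin 4 → U.CohC (U.pms L ι₁ V Γ') 1),
      ω 0 = U.pullC h 1 ω₀ ∧ ω 1 = U.pullC h 1 ω₁ ∧
      ω 2 ∈ U.Uiso Γ' K (Ψ 2) σ ∧ ω 3 ∈ U.Uiso Γ' K (Ψ 3) σ ∧
      U.period (U.pms L ι₁ V Γ') ω ≠ 0

/-- **(P♯) Free pairing step** (the Bergeron-shaped form of (P): both given forms may be re-translated separately).  Two
nonzero one-forms of types `(Ψ₀, Ψ₁)` at level `Γ` have pullbacks `f₀^*ω₀`, `f₁^*ω₁` to some level `Γ′`, and there are one-forms `ω₂, ω₃`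
of types `(Ψ₂, Ψ₃)` there with `∫ f₀^*ω₀ ∧ f₁^*ω₁ ∧ \overline{ω₂ ∧ ω₃} ≠ 0`.  SOURCES: as for `PairingAt` (header entry (P)) —
after Hecke projection of `ω₀, ω₁` to isotypic constituents (isotypic projectors of the finite-dimensional semisimple
Hecke module `H^{1,0}(P_Γ)` lie in the image of the Hecke algebra by the double-commutant theorem; the module is moreover
multiplicity-free: Rogawski, Ann. of Math. Stud. 123 (1990) Thm 13.3.1 and §14.6 (Prop. 14.6.2, Thms 14.6.4, 14.6.5) for the
inner forms `U(V₃,h)`, recorded in Dimitrov–Ramakrishnan, Doc. Math. 20 (2015) = arXiv:1401.1628 Thm 3.2 (iii)) and the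
projection formula `∫ T_g a ∧ b = ∫ π₂^*a ∧ π₁^*b` (this is why two different morphisms `f₀, f₁` are allowed),
Venkataramana's Thm 8 makes the translated wedge non-zero and the toric-period package pairs it; complementary lines
`W₂′ ⊕ W₃′ ≅ W₀′ ⊕ W₁′` by Landherr (`HodgeCM.Lemma33bLandherr`, signs by `StubTree.pairSum_of_isPerLTypes`).  WHY IT
MIGHT FAIL: the same archimedean-compatibility proviso as `PairingAt`; NOT a consequence of Bergeron's arXiv:math/0612447
Thm 1.2 as printed (theta KERNEL classes; his Remark covers four equal types only).  Implied by (V) ∧ (P)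
(`freePairingAt_of_virtualCup_pairing`); with (S) it gives `PeriodNV` (`periodNV_of_supply_freePairing`). -/
def FreePairingAt {L : CMField} {ι₁ : L →+* ℂ} (V : HermSpace3 L ι₁) (K : CMField) (Ψ : Fin 4 → CMType K)
    (σ : K →+* ℂ) : Prop :=
  ∀ (Γ : Level V) (ω₀ ω₁ : U.CohC (U.pms L ι₁ V Γ) 1),
    ω₀ ∈ U.Uiso Γ K (Ψ 0) σ → ω₁ ∈ U.Uiso Γ K (Ψ 1) σ → ω₀ ≠ 0 → ω₁ ≠ 0 →
    ∃ (Γ' : Level V) (f₀ f₁ : U.Mor (U.pms L ι₁ V Γ') (U.pms L ι₁ V Γ))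
      (ω : Fin 4 → U.CohC (U.pms L ι₁ V Γ') 1),
      ω 0 = U.pullC f₀ 1 ω₀ ∧ ω 1 = U.pullC f₁ 1 ω₁ ∧
      ω 2 ∈ U.Uiso Γ' K (Ψ 2) σ ∧ ω 3 ∈ U.Uiso Γ' K (Ψ 3) σ ∧
      U.period (U.pms L ι₁ V Γ') ω ≠ 0

variable {U}

/-- **`PeriodNV` from (S) and (P♯)** — PROVED: nonzero `ω₀ ∈ U_{Ψ₀}(Γ)`, `ω₁ ∈ U_{Ψ₁}(Γ)` (S); (P♯) gives the level, the two
pullbacks (still isotypic: `pullC_mem_Uiso`, `Fact_pull_comp`) and `ω₂, ω₃`; expand multilinearly (`periodNV_of_period_ne_zero`). -/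
theorem periodNV_of_supply_freePairing (hc : U.Fact_pull_comp) {L : CMField} {ι₁ : L →+* ℂ} {V : HermSpace3 L ι₁}
    {K : CMField} {Ψ : Fin 4 → CMType K} {σ : K →+* ℂ}
    (hS : U.TypeSupplyAt V K Ψ σ) (hP : U.FreePairingAt V K Ψ σ) : U.PeriodNV ι₁ V K Ψ σ := by
  obtain ⟨Γ, hΓ⟩ := hS
  obtain ⟨ω₀, h₀, hne₀⟩ := (Submodule.ne_bot_iff _).mp (hΓ 0)
  obtain ⟨ω₁, h₁, hne₁⟩ := (Submodule.ne_bot_iff _).mp (hΓ 1)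
  obtain ⟨Γ', f₀, f₁, ω, e₀, e₁, h₂, h₃, hper⟩ := hP Γ ω₀ ω₁ h₀ h₁ hne₀ hne₁
  refine periodNV_of_period_ne_zero Γ' ω ?_ hper
  intro i
  match i with
  | 0 => rw [e₀]; exact pullC_mem_Uiso hc f₀ K (Ψ 0) σ h₀
  | 1 => rw [e₁]; exact pullC_mem_Uiso hc f₁ K (Ψ 1) σ h₁
  | 2 => exact h₂
  | 3 => exact h₃

/-- **(V) ∧ (P) ⇒ (P♯)** — PROVED: translate the two forms until their cup product is nonzero (V), pair (P), and compose the
morphisms (`Fact_pull_comp`: `(f ∘ h)^* = h^* f^*`). -/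
theorem freePairingAt_of_virtualCup_pairing (hc : U.Fact_pull_comp) {L : CMField} {ι₁ : L →+* ℂ} {V : HermSpace3 L ι₁}
    {K : CMField} {Ψ : Fin 4 → CMType K} {σ : K →+* ℂ}
    (hV : U.VirtualCup11 V) (hP : U.PairingAt V K Ψ σ) : U.FreePairingAt V K Ψ σ := by
  intro Γ ω₀ ω₁ h₀ h₁ hne₀ hne₁
  obtain ⟨Γ₁, f, g, hcup⟩ := hV Γ ω₀ ω₁ hne₀ hne₁
  have h₀' : U.pullC f 1 ω₀ ∈ U.Uiso Γ₁ K (Ψ 0) σ := pullC_mem_Uiso hc f K (Ψ 0) σ h₀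
  have h₁' : U.pullC g 1 ω₁ ∈ U.Uiso Γ₁ K (Ψ 1) σ := pullC_mem_Uiso hc g K (Ψ 1) σ h₁
  obtain ⟨Γ₂, h, ω, e₀, e₁, h₂, h₃, hper⟩ := hP Γ₁ _ _ h₀' h₁' hcup
  refine ⟨Γ₂, U.comp h f, U.comp h g, ω, ?_, ?_, h₂, h₃, hper⟩
  · rw [e₀, pullC_comp_apply hc]
  · rw [e₁, pullC_comp_apply hc]

/-- **`PeriodNV` from (S), (V), (P)** — PROVED (through (P♯)). -/
theorem periodNV_of_pieces (hc : U.Fact_pull_comp) {L : CMField} {ι₁ : L →+* ℂ} {V : HermSpace3 L ι₁}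
    {K : CMField} {Ψ : Fin 4 → CMType K} {σ : K →+* ℂ}
    (hS : U.TypeSupplyAt V K Ψ σ) (hV : U.VirtualCup11 V) (hP : U.PairingAt V K Ψ σ) :
    U.PeriodNV ι₁ V K Ψ σ :=
  periodNV_of_supply_freePairing hc hS (freePairingAt_of_virtualCup_pairing hc hV hP)

/-- A period with a zero slot vanishes (multilinearity). -/
theorem period_eq_zero_of_apply_eq_zero (X : U.Var) (ω : Fin 4 → U.CohC X 1) (i : Fin 4) (h : ω i = 0) :
    U.period X ω = 0 := by
  rw [Universe.period_eq_period4]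
  match i, h with
  | 0, h => rw [h]; simp [Universe.period4, Universe.quadC, map_zero, LinearMap.zero_apply]
  | 1, h => rw [h]; simp [Universe.period4, Universe.quadC, map_zero]
  | 2, h => rw [h]; simp [Universe.period4, Universe.quadC, map_zero]
  | 3, h => rw [h]; simp [Universe.period4, Universe.quadC, map_zero]

/-- HONESTY: (S) is a consequence of `PeriodNV` (each pure pullback `F_i^*α_i` of a tuple with nonzero period is a
nonzero element of `U_{Ψ_i}(Γ)`), so (S) is strictly weaker than the statement it helps prove. -/
theorem typeSupplyAt_of_periodNV {L : CMField} {ι₁ : L →+* ℂ} {V : HermSpace3 L ι₁} {K : CMField}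
    {Ψ : Fin 4 → CMType K} {σ : K →+* ℂ} (h : U.PeriodNV ι₁ V K Ψ σ) : U.TypeSupplyAt V K Ψ σ := by
  obtain ⟨Γ, F, α, hα, hper⟩ := h
  refine ⟨Γ, fun i => ?_⟩
  rw [Submodule.ne_bot_iff]
  refine ⟨U.pullC (F i) 1 (α i), Submodule.subset_span ⟨F i, α i, hα i, rfl⟩, ?_⟩
  intro h0
  exact hper (period_eq_zero_of_apply_eq_zero _ _ i h0)

variable (U)

/-! ### The pieces under the PerL and the face binders; the headline theorems re-derived -/

/-- (S) for the PerL data (PerL v5 Thm 4.4's binders). -/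
def TypeSupplyPerL : Prop :=
  ∀ (K L : CMField) (j : K →+* L), IsNormalClosure ℚ K L →
    Module.finrank ℚ K = 6 → (Module.finrank ℚ L = 24 ∨ Module.finrank ℚ L = 48) →
    ∀ (φ : Fin 3 → (K →+* ℂ)), IsFrame φ →
    ∀ (ι₁ : L →+* ℂ), ι₁.comp j = φ 0 →
    ∀ (t : Fin 4 → CMType K), IsPerLTypes φ t →
    ∀ V : HermSpace3 L ι₁, U.TypeSupplyAt V K t (φ 0)

/-- (P) for the PerL data. -/
def PairingPerL : Prop :=
  ∀ (K L : CMField) (j : K →+* L), IsNormalClosure ℚ K L →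
    Module.finrank ℚ K = 6 → (Module.finrank ℚ L = 24 ∨ Module.finrank ℚ L = 48) →
    ∀ (φ : Fin 3 → (K →+* ℂ)), IsFrame φ →
    ∀ (ι₁ : L →+* ℂ), ι₁.comp j = φ 0 →
    ∀ (t : Fin 4 → CMType K), IsPerLTypes φ t →
    ∀ V : HermSpace3 L ι₁, U.PairingAt V K t (φ 0)

/-- (P♯) for the PerL data. -/
def FreePairingPerL : Prop :=
  ∀ (K L : CMField) (j : K →+* L), IsNormalClosure ℚ K L →
    Module.finrank ℚ K = 6 → (Module.finrank ℚ L = 24 ∨ Module.finrank ℚ L = 48) →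
    ∀ (φ : Fin 3 → (K →+* ℂ)), IsFrame φ →
    ∀ (ι₁ : L →+* ℂ), ι₁.comp j = φ 0 →
    ∀ (t : Fin 4 → CMType K), IsPerLTypes φ t →
    ∀ V : HermSpace3 L ι₁, U.FreePairingAt V K t (φ 0)

/-- (S) for the face data (rfwf v3 Thm 4.1's binders). -/
def TypeSupplyFace : Prop :=
  ∀ (F : CMField), IsGalois ℚ F → 6 ≤ Module.finrank ℚ F →
    ∀ (f : Face F) (ι₁ : F →+* ℂ), f.Admissible ι₁ →
    ∀ V : HermSpace3 F ι₁, U.TypeSupplyAt V F f.psi ι₁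

/-- (P) for the face data. -/
def PairingFace : Prop :=
  ∀ (F : CMField), IsGalois ℚ F → 6 ≤ Module.finrank ℚ F →
    ∀ (f : Face F) (ι₁ : F →+* ℂ), f.Admissible ι₁ →
    ∀ V : HermSpace3 F ι₁, U.PairingAt V F f.psi ι₁

/-- (P♯) for the face data. -/
def FreePairingFace : Prop :=
  ∀ (F : CMField), IsGalois ℚ F → 6 ≤ Module.finrank ℚ F →
    ∀ (f : Face F) (ι₁ : F →+* ℂ), f.Admissible ι₁ →
    ∀ V : HermSpace3 F ι₁, U.FreePairingAt V F f.psi ι₁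

/-- **PerL Thm 4.4** from the model facts and the two pieces (S), (P♯) (the two-piece closed split). -/
theorem perL44_of_supply_freePairing (M : U.ModelAxioms) (hS : U.TypeSupplyPerL) (hP : U.FreePairingPerL) :
    U.PerL44 := by
  intro K L j hN hK hL φ hφ ι₁ hι t ht V
  exact periodNV_of_supply_freePairing M.pull_comp (hS K L j hN hK hL φ hφ ι₁ hι t ht V)
    (hP K L j hN hK hL φ hφ ι₁ hι t ht V)

/-- **rfwf Thm 4.1** from the model facts and the two face pieces (S), (P♯). -/
theorem periodThmF_of_supply_freePairing (M : U.ModelAxioms) (hS : U.TypeSupplyFace) (hP : U.FreePairingFace) :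
    U.PeriodThmF := by
  intro F hG h6 f ι₁ hι V
  exact periodNV_of_supply_freePairing M.pull_comp (hS F hG h6 f ι₁ hι V) (hP F hG h6 f ι₁ hι V)

/-- **COR-CM** from the 28 model facts, the two face pieces (S), (P♯) and the two face-reduction inputs. -/
theorem COR_CM_of_supply_freePairing (M : U.ModelAxioms) (hS : U.TypeSupplyFace) (hP : U.FreePairingFace)
    (hPo : U.PohlmannSpan) (hQ : U.Qw8Sufficiency) : U.HC_CM :=
  Assembly.hc_cm_of U
    (Assembly.w_rk4_of U (periodThmF_of_supply_freePairing U M hS hP) (StubTree.prop22_surfaceCriterion U M)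
      StubTree.landherr_exists M.pms_dim StubTree.admissible_exists)
    (StubTree.faceReduction_holds U hPo hQ) (StubTree.lemma81_holds U M)

/-- **PerL Thm 4.4** from the model facts, Venkataramana's theorem and the two pieces (S), (P). -/
theorem perL44_of_pieces (M : U.ModelAxioms) (hV : U.Fact_virtualCup11) (hS : U.TypeSupplyPerL)
    (hP : U.PairingPerL) : U.PerL44 := by
  intro K L j hN hK hL φ hφ ι₁ hι t ht V
  have h4 : 4 ≤ Module.finrank ℚ L := by rcases hL with h | h <;> omega
  exact periodNV_of_pieces M.pull_comp (hS K L j hN hK hL φ hφ ι₁ hι t ht V) (hV L ι₁ h4 V)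
    (hP K L j hN hK hL φ hφ ι₁ hι t ht V)

/-- **rfwf Thm 4.1** (period theorem over `F`) from the model facts, Venkataramana's theorem and (S), (P). -/
theorem periodThmF_of_pieces (M : U.ModelAxioms) (hV : U.Fact_virtualCup11) (hS : U.TypeSupplyFace)
    (hP : U.PairingFace) : U.PeriodThmF := by
  intro F hG h6 f ι₁ hι V
  have h4 : 4 ≤ Module.finrank ℚ F := by omega
  exact periodNV_of_pieces M.pull_comp (hS F hG h6 f ι₁ hι V) (hV F ι₁ h4 V) (hP F hG h6 f ι₁ hι V)

/-- **PerL** (`W_per^L`), end-to-end from the pieces (Landherr existence is proved: `StubTree.landherr_exists`). -/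
theorem perL_of_pieces (M : U.ModelAxioms) (hV : U.Fact_virtualCup11) (hS : U.TypeSupplyPerL)
    (hP : U.PairingPerL) : U.PerL :=
  Assembly.perL_of_perL44 U StubTree.landherr_exists (perL44_of_pieces U M hV hS hP)

/-- **`W^{RK4}`** from the pieces. -/
theorem w_rk4_of_pieces (M : U.ModelAxioms) (hV : U.Fact_virtualCup11) (hS : U.TypeSupplyFace)
    (hP : U.PairingFace) : U.W_RK4 :=
  Assembly.w_rk4_of U (periodThmF_of_pieces U M hV hS hP) (StubTree.prop22_surfaceCriterion U M)
    StubTree.landherr_exists M.pms_dim StubTree.admissible_exists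

/-- **COR-CM** from the 28 model facts, Venkataramana's Theorem 8 (`Fact_virtualCup11`), the two face pieces (S), (P), and
the two face-reduction inputs (Pohlmann; [QW8]+Milne).  Compared with `Assembly.COR_CM` the realisation input
`RealisationExistsFace` (17 fields of posited analytic data) is replaced by two statements over the geometric primitives. -/
theorem COR_CM_of_pieces (M : U.ModelAxioms) (hV : U.Fact_virtualCup11) (hS : U.TypeSupplyFace) (hP : U.PairingFace)
    (hPo : U.PohlmannSpan) (hQ : U.Qw8Sufficiency) : U.HC_CM :=
  Assembly.hc_cm_of U (w_rk4_of_pieces U M hV hS hP) (StubTree.faceReduction_holds U hPo hQ)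
    (StubTree.lemma81_holds U M)

/-! ### Comparison with the package's open input

The realisation input implies the supply piece (S): `ThetaRealisation → PeriodNV` is Thm 4.4
(`StubTree.thm44_of_realisation`) and `PeriodNV → TypeSupplyAt` is `typeSupplyAt_of_periodNV`.  So on both binder
sets (S) is WEAKER than `RealisationExists*`.  (No such comparison is claimed for (P)/(P♯): a realisation gives one
non-zero period, not the pairing for every wedge; conversely (V) ∧ (S) ∧ (P) give `PeriodNV` but not the 17-field
structure — dossier `REDUCTION.md` §0.1.) -/

/-- `RealisationExistsPerL → TypeSupplyPerL` (model facts used only through Thm 4.4). -/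
theorem typeSupplyPerL_of_realisationExistsPerL (M : U.ModelAxioms) (hR : U.RealisationExistsPerL) :
    U.TypeSupplyPerL := by
  intro K L j hN hK hL φ hφ ι₁ hι t ht V
  obtain ⟨R⟩ := hR K L j hN hK hL φ hφ ι₁ hι t ht V
  exact typeSupplyAt_of_periodNV (StubTree.thm44_of_realisation M R)

/-- `RealisationExistsFace → TypeSupplyFace`. -/
theorem typeSupplyFace_of_realisationExistsFace (M : U.ModelAxioms) (hR : U.RealisationExistsFace) :
    U.TypeSupplyFace := by
  intro F hG h6 f ι₁ hadm V
  obtain ⟨R⟩ := hR F hG h6 f ι₁ hadm V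
  exact typeSupplyAt_of_periodNV (StubTree.thm44_of_realisation M R)

end Universe

end HodgeCM

end
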